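import Summits.ResolutionOfSingularities.ResolutionOfSingularities.Theorems.EquisingularLiftEquisingularLiftNatTowerBAwayTransport
import Summits.ResolutionOfSingularities.ResolutionOfSingularities.Theorems.EquisingularLiftEquisingularLiftNatTransversalStrictTransformRegular
import Summits.ResolutionOfSingularities.ResolutionOfSingularities.Theorems.EquisingularLiftEquisingularLiftNatCarrierPairStrictTransformRegular
import Summits.ResolutionOfSingularities.ResolutionOfSingularities.Theorems.EquisingularLiftEquisingularLiftNatStrictTransformSupport
import HarnessLib

/-!
# [OURS · L1 W4.5(b) · EL♮(3)] T23-A′ brick «B-TRACE» at `Exc₃` level: a retained member through a round whose centre CROSSES it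

res-L1-w45b-stub-4 g10 (T23-A/T23-A′ engine owner; SIG v2 `L/res-L1-w45b-stub-4/T23Aprime-TransversalTransport.sig.v2.lean` 767f3543c2b2e4ae;
desk R6 (ii) / R12′ / R13). Crux EL♮(3) = stmt-ResolutionOfSingularities-20148 (parent stmt-…-20038), route `EquisingularLift`, line `sections`.
OURS; NOT a statement of any manuscript; AI-written, weaker than expert review. DEF-FREE; no `sorry`; standard axioms;
`--supports stmt-ResolutionOfSingularities-20148 --as helper`.

WHAT. The companion of B-AWAY (`Tower.exc₃_transport_away`, …NatTowerBAwayTransport p602624) for the THIRD alternative of the widened transport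
rule: the round blows the stage `X` up along a centre `C` (`τ`, downstairs `υ₂` along `J`, `supp J = D`, `j₂ ≫ τ = υ₂ ≫ jG`) and the retained
member `F` carries the shadow-forgotten datum `Exc₃ … F hF ∅ X σ jG` with model `𝓕`. If the model CROSSES the centre with simple normal crossings
(`hsnc`, the output of (A′-1) v2 `hasSNCWith_member_centre_of_trace_transversal` — res-L1-w45b-lead-2 — from the downstairs clauses (T1)/(T2)) and the
special-fibre trace of its strict transform is the downstairs strict transform (`htrace`, the output of (A′-3) — res-L1-w45b-stub-2/lead-1), then
`closure υ₂⁻¹(F ∖ D)` carries the datum `Exc₃ … ∅ X'' (τ ≫ σ) j₂` with model the STRICT TRANSFORM `St_C 𝓕`: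
(e-i′) `htrace`; (e-ii′) stalkwise principal — tree `isPrincipal_stalkIdeal_strictTransformIdeal` (…NatCarrierPairStrictTransformRegular, needs
`C ≠ ⊥`, `X` regular integral, `V(C)` regular); (e-iii′) regular — (A′-2) `isRegular_subscheme_strictTransformIdeal_of_hasSNCWith` (p606871);
(e-iv′) off the generic points of `Y` — `support_strictTransformIdeal_subset` (…NatStrictTransformSupport); (e-v′) the `Ruled` datum — hypothesis
`hRuledSt` (at the assembly's datum «`V(·)` is `O`-flat» it is stub-2's `flat_strictTransform_subschemeι_comp`, (A′-4)); shadow `∅`.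
* `Tower.exc₃_transport_transversal` — the brick; `Tower.noRound_transport` — `NoRound` persists (shared with B-AWAY's first case).
[cite: GortzWedhorn2020, Prop. 13.91 and (13.19)] [OURS · L1 W4.5b · T23-A′]
-/

set_option linter.dupNamespace false -- mandated namespace `Summit.<Summit>.<Problem>` of this single-conjunct summit

noncomputable section

open CategoryTheory CategoryTheory.Limits AlgebraicGeometry TopologicalSpace Topology IsLocalRing
open Literature.AlgebraicGeometry.Resolution
open AlgebraicGeometry.Scheme.IdealSheafData
open Summit.ResolutionOfSingularities.ResolutionOfSingularities.Theses.EquisingularLift.Split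

namespace Summit.ResolutionOfSingularities.ResolutionOfSingularities.Cruxes.EquisingularLiftNat.Sections

section Transversal

variable (O : Type) [CommRing O] (k : Type) [Field k] (θ : O →+* k) (P : Scheme.{0}) (q : P ⟶ Spec (.of O)) (Y : Set P)
  (Ruled : Tower.RuledDatum P)
  {F₉ : Scheme.{0}} {Z₉ : Set F₉} {hZ₉ : IsClosed Z₉} {F₁₀ : Scheme.{0}} {υ' : F₁₀ ⟶ F₉}
  {G G' X X'' : Scheme.{0}} {γ : G ⟶ F₁₀} {σ : X ⟶ P} {jG : G ⟶ X}
  [IsLocallyNoetherian X] [IsLocallyNoetherian X''] [IsIntegral X]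
  {τ : X'' ⟶ X} {C : X.IdealSheafData} (hτ : IsBlowup τ C) (hXreg : Scheme.IsRegular X) (hCreg : Scheme.IsRegular C.subscheme)
  (hC0 : C ≠ ⊥)
  {D : Set G} {υ₂ : G' ⟶ G} {j₂ : G' ⟶ X''}

/-- `NoRound` persists when a closed set shrinks to `closure υ₂⁻¹(F ∖ D) ⊆ υ₂⁻¹ F` along a step `υ₂`. [OURS · pure topology] -/
theorem Tower.noRound_transport {F : Set G} (hF : IsClosed F) (hno : Tower.NoRound υ' G γ F) :
    Tower.NoRound υ' G' (υ₂ ≫ γ) (closure (υ₂ ⁻¹' (F \ D))) := by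
  have hsub : closure (υ₂ ⁻¹' (F \ D)) ⊆ υ₂ ⁻¹' F := closure_minimal (fun z hz => hz.1) (hF.preimage υ₂.continuous)
  refine hno.subset ?_
  rintro _ ⟨z, hz, rfl⟩
  exact ⟨υ₂ z, hsub hz, by rw [Scheme.Hom.comp_apply, Scheme.Hom.comp_apply, Scheme.Hom.comp_apply]⟩

include hτ hXreg hCreg hC0

/-- **B-TRACE — a retained member through a round whose centre crosses it, at `Exc₃` level and an explicit stage** (module docstring):
given the snc of the member's model with the centre (`hsnc`, (A′-1)) and the trace of its strict transform (`htrace`, (A′-3)) as hypotheses,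
the strict transform is the new model of `closure υ₂⁻¹(F ∖ D)`. [cite: GortzWedhorn2020, Prop. 13.91 and (13.19)] [OURS · L1 W4.5b · T23-A′];
NOT a statement of the manuscript. -/
theorem Tower.exc₃_transport_transversal
    (hRuledSt : ∀ (F : Set G) (F' : Set G') (𝓕 : X.IdealSheafData), Ruled F₉ Z₉ hZ₉ F₁₀ υ' G γ F X σ jG 𝓕 →
      Ruled F₉ Z₉ hZ₉ F₁₀ υ' G' (υ₂ ≫ γ) F' X'' (τ ≫ σ) j₂ (strictTransformIdeal τ C 𝓕))
    {F : Set G} (hF : IsClosed F) (hExc : Tower.Exc₃ O P q Y Ruled Z₉ hZ₉ υ' G γ F hF ∅ X σ jG)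
    (hsnc : ∀ 𝓕 : X.IdealSheafData, 𝓕.comap jG = vanishingIdeal (⟨F, hF⟩ : Closeds G) →
      (∀ z : X, (stalkIdeal 𝓕 z).IsPrincipal) → Scheme.IsRegular 𝓕.subscheme → HasSNCWith [𝓕] C)
    (htrace : ∀ 𝓕 : X.IdealSheafData, 𝓕.comap jG = vanishingIdeal (⟨F, hF⟩ : Closeds G) → HasSNCWith [𝓕] C →
      (strictTransformIdeal τ C 𝓕).comap j₂ =
        vanishingIdeal (⟨closure (υ₂ ⁻¹' (F \ D)), isClosed_closure⟩ : Closeds G')) :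
    ∀ hF' : IsClosed (closure (υ₂ ⁻¹' (F \ D))),
      Tower.Exc₃ O P q Y Ruled Z₉ hZ₉ υ' G' (υ₂ ≫ γ) (closure (υ₂ ⁻¹' (F \ D))) hF' ∅ X'' (τ ≫ σ) j₂ := by
  intro hF'
  rcases hExc with hno | ⟨𝓕, he1, he2, he3, he4, he5, -⟩
  · exact Or.inl (Tower.noRound_transport hF hno)
  have hE : HasSNCWith [𝓕] C := hsnc 𝓕 he1 he2 he3
  refine Or.inr ⟨strictTransformIdeal τ C 𝓕, ?_, fun z => isPrincipal_stalkIdeal_strictTransformIdeal hXreg hCreg hτ hC0 𝓕 he2 z,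
    isRegular_subscheme_strictTransformIdeal_of_hasSNCWith hE hτ, ?_, hRuledSt F _ 𝓕 he5, Or.inl rfl⟩
  · -- (e-i′) the trace
    rw [htrace 𝓕 he1 hE]
  · -- (e-iv′) off the generic points of `Y`: `supp St ⊆ τ⁻¹ supp 𝓕`
    rintro _ ⟨z, hz, rfl⟩
    have hz' : τ z ∈ (𝓕.support : Set X) := by
      have h1 := support_strictTransformIdeal_subset τ C 𝓕 hz
      have hcl : closure (τ ⁻¹' ((𝓕.support : Set X) \ (C.support : Set X))) ⊆ τ ⁻¹' (𝓕.support : Set X) :=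
        closure_minimal (fun w hw => hw.1) (𝓕.support.isClosed.preimage τ.continuous)
      exact hcl h1
    rw [Scheme.Hom.comp_apply]
    exact he4 ⟨τ z, hz', rfl⟩

/-- **B-TRACE, full-datum interface.** The same brick with the dischargers `hsnc` / `htrace` receiving EVERY clause of the member's datum
(trace, principal stalks, regularity, position off the generic points of `Y`, and the `Ruled` datum — at the assembly's `FE` the `O`-flatness that
(A′-3) needs), so that a host-parametrised round core can feed them from stage-level dischargers. [cite: GortzWedhorn2020, Prop. 13.91 and (13.19)]
[OURS · L1 W4.5b · T23-A′]; NOT a statement of the manuscript. -/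
theorem Tower.exc₃_transport_transversal'
    (hRuledSt : ∀ (F : Set G) (F' : Set G') (𝓕 : X.IdealSheafData), Ruled F₉ Z₉ hZ₉ F₁₀ υ' G γ F X σ jG 𝓕 →
      Ruled F₉ Z₉ hZ₉ F₁₀ υ' G' (υ₂ ≫ γ) F' X'' (τ ≫ σ) j₂ (strictTransformIdeal τ C 𝓕))
    {F : Set G} (hF : IsClosed F) (hExc : Tower.Exc₃ O P q Y Ruled Z₉ hZ₉ υ' G γ F hF ∅ X σ jG)
    (hsnc : ∀ 𝓕 : X.IdealSheafData, 𝓕.comap jG = vanishingIdeal (⟨F, hF⟩ : Closeds G) →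
      (∀ z : X, (stalkIdeal 𝓕 z).IsPrincipal) → Scheme.IsRegular 𝓕.subscheme →
      σ '' (𝓕.support : Set X) ⊆ {p : P | ¬ IsGenericPoint p Y} → Ruled F₉ Z₉ hZ₉ F₁₀ υ' G γ F X σ jG 𝓕 → HasSNCWith [𝓕] C)
    (htrace : ∀ 𝓕 : X.IdealSheafData, 𝓕.comap jG = vanishingIdeal (⟨F, hF⟩ : Closeds G) →
      (∀ z : X, (stalkIdeal 𝓕 z).IsPrincipal) → Scheme.IsRegular 𝓕.subscheme →
      σ '' (𝓕.support : Set X) ⊆ {p : P | ¬ IsGenericPoint p Y} → Ruled F₉ Z₉ hZ₉ F₁₀ υ' G γ F X σ jG 𝓕 → HasSNCWith [𝓕] C →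
      (strictTransformIdeal τ C 𝓕).comap j₂ =
        vanishingIdeal (⟨closure (υ₂ ⁻¹' (F \ D)), isClosed_closure⟩ : Closeds G')) :
    ∀ hF' : IsClosed (closure (υ₂ ⁻¹' (F \ D))),
      Tower.Exc₃ O P q Y Ruled Z₉ hZ₉ υ' G' (υ₂ ≫ γ) (closure (υ₂ ⁻¹' (F \ D))) hF' ∅ X'' (τ ≫ σ) j₂ := by
  intro hF'
  rcases hExc with hno | ⟨𝓕, he1, he2, he3, he4, he5, -⟩
  · exact Or.inl (Tower.noRound_transport hF hno)
  have hE : HasSNCWith [𝓕] C := hsnc 𝓕 he1 he2 he3 he4 he5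
  refine Or.inr ⟨strictTransformIdeal τ C 𝓕, ?_, fun z => isPrincipal_stalkIdeal_strictTransformIdeal hXreg hCreg hτ hC0 𝓕 he2 z,
    isRegular_subscheme_strictTransformIdeal_of_hasSNCWith hE hτ, ?_, hRuledSt F _ 𝓕 he5, Or.inl rfl⟩
  · -- (e-i′) the trace
    rw [htrace 𝓕 he1 he2 he3 he4 he5 hE]
  · -- (e-iv′) off the generic points of `Y`: `supp St ⊆ τ⁻¹ supp 𝓕`
    rintro _ ⟨z, hz, rfl⟩
    have hz' : τ z ∈ (𝓕.support : Set X) := by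
      have h1 := support_strictTransformIdeal_subset τ C 𝓕 hz
      have hcl : closure (τ ⁻¹' ((𝓕.support : Set X) \ (C.support : Set X))) ⊆ τ ⁻¹' (𝓕.support : Set X) :=
        closure_minimal (fun w hw => hw.1) (𝓕.support.isClosed.preimage τ.continuous)
      exact hcl h1
    rw [Scheme.Hom.comp_apply]
    exact he4 ⟨τ z, hz', rfl⟩

end Transversal

end Summit.ResolutionOfSingularities.ResolutionOfSingularities.Cruxes.EquisingularLiftNat.Sections

end
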